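import Summits.NavierStokesRegularity.NavierStokesRegularity.Theorems.ExtremiserTransienceWeakClassDivFree
import Summits.NavierStokesRegularity.NavierStokesRegularity.Theorems.ExtremiserTransienceWeakClassGradient
import Literature.Analysis.FluidPDE.NSBoundedMildOseenClassical
import HarnessLib

/-!
# Route `ExtremiserTransience`, LINE g5-α repair (seat ns-idea-5 g5): the weak one-slice class is SMOOTH with a GRADIENT Type-I bound — unconditional form

`--supports stmt-NavierStokesRegularity-27823` (`PlateauSliceRigidity`, reduced to the Type-I ancient local energy budget by
`plateauSliceRigidity_of_budget`, p636343).  Composition of the two landed class facts `weakClass_isWeaklyDivFree` (p636614: every member of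
the weak class has weakly divergence-free slices) and `weakClass_gradTypeI_of_divFree` (p637014: KNSS (4.6) on windows), so that the budget
prover can start from the three class clauses alone: every `W` of the class is `C^∞` on each negative slice with `(−σ)‖∇W(σ,·)‖ ≤ K₁` and its
slices are div-free in the classical sense.  HONEST FRAMING: regularity bookkeeping for hypothetical blow-up limits; nothing about
Navier–Stokes regularity or blow-up is proved here and no summit is proved by a line. [cite: KochNadirashviliSereginSverak2009, Prop. 4.1 (4.6)]
-/

noncomputable section

namespace Summit.NavierStokesRegularity.NavierStokesRegularity.Theorems.ExtremiserTransience
set_option linter.dupNamespace false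

open Set Function MeasureTheory Filter Topology
open scoped RealInnerProductSpace ContDiff
open Literature.Analysis Literature.Analysis.FluidPDE

/-- **Gradient Type-I bound and slice smoothness for the weak one-slice class, unconditionally** (div-freeness supplied by
`weakClass_isWeaklyDivFree`). [cite: KochNadirashviliSereginSverak2009, Prop. 4.1 (4.6)] -/
theorem weakClass_gradTypeI (W : ℝ → EuclideanSpace ℝ (Fin 3) → EuclideanSpace ℝ (Fin 3)) (K : ℝ)
    (hcont : ContinuousOn (Function.uncurry W) (Set.Iio (0 : ℝ) ×ˢ Set.univ))
    (hmild : ∀ s t : ℝ, s < t → t < 0 → ∀ x, W t x =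
      Literature.Analysis.FluidPDE.heatFlow (W s) (t - s) x - Literature.Analysis.FluidPDE.oseenDuhamel 1 s W W t x)
    (hdec : ∀ t : ℝ, t < 0 → ∀ x, Real.sqrt (-t) * ‖W t x‖ ≤ K) :
    ∃ K₁ : ℝ, 0 ≤ K₁ ∧ ∀ σ < 0, ContDiff ℝ ∞ (W σ) ∧ ∀ x, (-σ) * ‖fderiv ℝ (W σ) x‖ ≤ K₁ :=
  weakClass_gradTypeI_of_divFree W K hcont hmild hdec (weakClass_isWeaklyDivFree W K hcont hmild hdec)

/-- **Classical divergence-freeness of the slices of the weak one-slice class**: a weakly divergence-free `C¹` field is divergence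
free. [folklore] -/
theorem weakClass_isDivFree (W : ℝ → EuclideanSpace ℝ (Fin 3) → EuclideanSpace ℝ (Fin 3)) (K : ℝ)
    (hcont : ContinuousOn (Function.uncurry W) (Set.Iio (0 : ℝ) ×ˢ Set.univ))
    (hmild : ∀ s t : ℝ, s < t → t < 0 → ∀ x, W t x =
      Literature.Analysis.FluidPDE.heatFlow (W s) (t - s) x - Literature.Analysis.FluidPDE.oseenDuhamel 1 s W W t x)
    (hdec : ∀ t : ℝ, t < 0 → ∀ x, Real.sqrt (-t) * ‖W t x‖ ≤ K) :
    ∀ σ < 0, VectorCalculus.IsDivFree (W σ) := by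
  intro σ hσ
  obtain ⟨K₁, -, hK₁⟩ := weakClass_gradTypeI W K hcont hmild hdec
  exact (weakClass_isWeaklyDivFree W K hcont hmild hdec σ hσ).isDivFree_of_contDiff
    (((hK₁ σ hσ).1).of_le (by exact_mod_cast le_top))

end Summit.NavierStokesRegularity.NavierStokesRegularity.Theorems.ExtremiserTransience
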